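import Literature.NumberTheory.ModularSymbols.FullLevelHomologyHeckeChain
import Literature.RepresentationTheory.FiniteGroups.GL2ModularPrincipalSeriesLatticeReduction
import Literature.RepresentationTheory.FiniteGroups.GL2ModularPrincipalSeriesLatticeTeichmuller
import Literature.NumberTheory.EllipticCurves.KellerYin2024.PotentiallyGoodOrdinaryPConverse
import Literature.NumberTheory.EllipticCurves.GlobalMinimalModel
import Literature.NumberTheory.DiophantineGeometry.Conductor
import Mathlib.AlgebraicGeometry.EllipticCurve.LFunction
import Mathlib.RingTheory.SimpleModule.Isotypic
import HarnessLib

/-!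
# The tame principal-series TYPE of the full-level homology of a modular curve at an additive prime of
# potentially good ordinary reduction (Eichler–Shimura at level `K(p)K₀(M)`, local–global compatibility, and the
# `K`-type of a tamely ramified principal series)

Topic `Literature/NumberTheory/EllipticCurves`, namespace `Literature.NumberTheory.EllipticCurves`.  ONE NAMED FACT
(`def … : Prop`, D-0014: a published theorem, cited to the places that prove it, asserted nowhere, no `sorry`, no
instance, no notation).  Nothing about BSD, Manin constants or period lattices is asserted here.

THE OBJECTS (all in the tree).  For a prime `p` and `M` with `p ∤ M` the full-level carrier
`H1carrier k p M = H₁(Γ₀(M), k[GL₂(ℤ/p)])` (`FullLevelHomologyCarrier`; by Shapiro and the Borel construction this is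
`H₁(Y(K(p)K₀(M))(ℂ), k)`, the open modular curve of full level `p` and `Γ₀(M)`-structure away from `p`, with its
`p − 1` components `Γ(p) ∩ Γ₀(M) \ ℍ`), its right `GL₂(𝔽_p)`-action `H1carrierRep`, and the Hecke operators
`heckeT k p M hq hqp = T_q` (`q ≠ p` prime; `FullLevelHomologyHeckeChain`, Shimura (8.3.2)).  The tame principal series
of `GL₂(𝔽_p)` in Bruhat coordinates is `coordRep χ₁ χ₂` (`GL2ModularPrincipalSeriesLatticeReduction`,
`= Ind_{B(𝔽_p)}^{GL₂(𝔽_p)}(χ₁ ⊗ χ₂)` transported along the Bruhat basis), and `Kato2004.teichmullerChar p = ω̃` is the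
Teichmüller character `𝔽_pˣ → ℤ_pˣ`.

THE FACT `fullLevelHomology_isIsotypic_tamePrincipalSeries`.  Let `W/ℚ` be an elliptic curve of conductor `p²M`,
`p ∤ M`, `p ≥ 5`, with potentially good ORDINARY reduction at `p`, semistability defect
`e = 12 / gcd(12, v_p(Δ_min)) ≠ 2` (so `e ∈ {3, 4, 6}`, Kodaira types II, III, IV, IV*, III*, II*), and let `b` with
`e · b = p − 1`.  Then for every field `K ⊇ ℚ_p` and every `GL₂(𝔽_p)`-equivariant `ℤ_p`-linear map `Φ` from
`H₁(Y(K(p)K₀(M)), ℤ_p)` onto (a spanning set of) a finite-dimensional `K`-representation `V` on which every `T_q`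
(`q ≠ p` prime) acts through the scalar `a_q(W)`, the `K[GL₂(𝔽_p)]`-module `V` is ISOTYPIC of type the tame
principal series `Ind(ω̃^{p−1−b} ⊗ ω̃ᵇ) = Ind(ω̃^{−b} ⊗ ω̃ᵇ)` (Mathlib `IsIsotypicOfType`: every simple submodule is
isomorphic to it).  In words: **the `f_W`-part of `H₁(Y(K(p)K₀(M)), K)` is `Ind(ω̃^{−b} ⊗ ω̃ᵇ)`-isotypic.**

WHY IT IS TRUE (the printed chain; each link is cited on the declaration):
(1) [ConradDiamondTaylor1999, §5.3 p. 541] `H = lim H¹(X_U, ℚ̄) = ⊕_π (B_π⁺ ⊕ B_π⁻)`, `B_π^± ≅ π^∞`, and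
    `H¹(X_U, ℚ̄) = H^U` — Eichler–Shimura / Matsushima–Murakami at arbitrary level ([ShimuraIATAF1971, Thm. 8.4 and
    Prop. 8.5]; [Langlands1973, §2]); the boundary of the open curve carries only Eisenstein systems
    `T_q = 1 + q` ([AshStevens1986, §1]), which differ from `a_q(W)` (`|a_q(W)| ≤ 2√q`); by strong multiplicity one and
    Chebotarev (traces `a_q(W)` for all `q ∤ pM` determine `ρ_{f_W,ℓ}`, hence `π`), the `a_q(W)`-part of `H₁(Y_U, K)`,
    `U = K(p)K₀(M)`, is `(π_{f_W}^∞)^U ⊗ K²` with `GL₂(𝔽_p) = GL₂(ℤ_p)/K(p)` acting on `π_{f_W,p}^{K(p)}`.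
(2) [ConradDiamondTaylor1999, Lemma 7.1.3 (2) with Prop. B.4.2, p. 552] for `W` with potentially good ordinary
    reduction at `p ≥ 3` the Weil–Deligne type is `WD(ρ_W)|_{I_p} ≅ ω̃ʲ ⊕ ω̃^{−j}`; the image of inertia is the cyclic
    group `Φ_p` of order `e = 12/gcd(12, v_p(Δ_min))` ([Serre1972PointsOrdreFini, §5.6 p. 312];
    [SerreTate1968GoodReduction, §2 Cor. 2]), so `ω̃ʲ` has exact order `e ∣ p − 1` and, `(ℤ/e)ˣ = {±1}` for
    `e ∈ {3,4,6}`, `{ω̃ʲ, ω̃^{−j}} = {ω̃ᵇ, ω̃^{−b}}` with `b = (p−1)/e` ([Rohrlich1994CRM, §4]).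
(3) [Carayol1986ASENS, Thm. (A)] local–global compatibility at `p ≠ ℓ`: `WD(ρ_{f_W,ℓ}|_{G_p})` is the Langlands
    parameter of `π_{f_W,p}`, so `WD(π_{f_W,p})|_{I_p} ≅ ω̃ᵇ ⊕ ω̃^{−b}`.
(4) [ConradDiamondTaylor1999, Lemma 4.2.4 (2), p. 538] for `χ₁ ≠ χ₂`: `WD(Π)|_{I_p} ≅ χ₁η ⊕ χ₂η` implies
    `Π^{K(p)} ≅ I(χ₁, χ₂) = Ind_{B(𝔽_p)}^{GL₂(𝔽_p)}(χ₁ ⊗ χ₂)` as a `GL₂(𝔽_p)`-module (Casselman); here `χ₁ ≠ χ₂` because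
    `2b < p − 1` (`e ≥ 3`), and `I(ω̃ᵇ, ω̃^{−b}) ≅ I(ω̃^{−b}, ω̃ᵇ)` is absolutely irreducible and isomorphic to its own
    contragredient and transpose-inverse twist, so the isotypic type does not depend on left/right conventions.
Hence every Hecke-trivialised (`T_q = a_q(W)`) finite-dimensional `K[GL₂(𝔽_p)]`-quotient of `H₁(Y_U, ℤ_p) ⊗ K` is a
quotient of the `a_q(W)`-generalised eigenspace, i.e. of `I(ω̃^{−b}, ω̃ᵇ)_K^{⊕ 2}`, and is isotypic of that type (over
any `K ⊇ ℚ_p`, the type being absolutely irreducible and defined over `ℤ_p`).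

WHAT IS DELIBERATELY NOT HERE.  No multiplicity (`= 2`) is asserted; nothing is said at `e = 2` (type `I₀*`, where the
`K(p)`-invariants are the reducible `χ∘det ⊕ sp_χ`) nor for potentially supersingular `p` (cuspidal type `Θ(χ)`,
[ConradDiamondTaylor1999, Lemma 4.2.4 (3)]); no integral / mod-`p` statement (those are the Serre-weight questions).
TODO(general form): the same for any newform `f` of level `p²M` whose local type at `p` is a tamely ramified principal
series `I(χ₁, χ₂)`, `χ₁ ≠ χ₂` — the tree has no vocabulary for «the local type of `f` at `p`» on the classical side yet,
so the elliptic-curve case (where the type is read off `v_p(Δ_min)` and ordinarity) is stated.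

Consumer: route BSD/TeichmullerTwistDescent, crux `TwistedPeriodLatticeSaturation` (stmt-BirchSwinnertonDyer-25368), input
(I1ᴷ) `TamePrincipalSeriesFunctionalOverField` of `Summits/…/TeichmullerTwistDescentCarrierDefs.lean` (the spread lattice
`Λ_Q(f_W) ⊗ K` is such a Hecke-trivialised quotient, `FullLevelHomologySpreadLatticeHecke.spreadPeriod_heckeT`).

## References (held copies page-verified where marked)

* B. Conrad, F. Diamond, R. Taylor, *Modularity of certain potentially Barsotti–Tate Galois representations*, J. Amer.
  Math. Soc. 12 (1999) — Lemma 4.2.4 p. 538, §5.3 p. 541 (decomposition of `H = lim H¹(X_U, ℚ̄)`), Lemma 7.1.3 and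
  Prop. B.4.2 p. 552 (held: `paper:doi-10-1090-s0894-0347-99-00287-8`, pp. 18–21, 32). [ConradDiamondTaylor1999]
* H. Carayol, *Sur les représentations ℓ-adiques associées aux formes modulaires de Hilbert*, Ann. Sci. ÉNS 19 (1986),
  Thm. (A). [Carayol1986ASENS]
* J.-P. Serre, *Propriétés galoisiennes des points d'ordre fini des courbes elliptiques*, Invent. Math. 15 (1972), §5.6
  p. 312 (`Φ_p` cyclic of order `12/gcd(12, v_p(Δ))` for `p ≥ 5`). [Serre1972PointsOrdreFini]
* J.-P. Serre, J. Tate, *Good reduction of abelian varieties*, Ann. of Math. 88 (1968), §2 Thm. 2, Cor. 2–3.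
  [SerreTate1968GoodReduction]
* D. Rohrlich, *Elliptic curves and the Weil–Deligne group*, CRM Proc. Lecture Notes 4 (1994), §4 (the representation `σ_{E,p}` of the Weil–Deligne group attached to `ρ_{E,ℓ}`). [Rohrlich1994CRM]
* G. Shimura, *Introduction to the arithmetic theory of automorphic functions* (1971), Thm. 8.4, Prop. 8.5, §8.3 (8.3.2).
  [ShimuraIATAF1971]
* R. P. Langlands, *Modular forms and ℓ-adic representations*, Antwerp II, LNM 349 (1973), §2–3. [Langlands1973]
* A. Ash, G. Stevens, *Modular forms in characteristic ℓ and special values of their L-functions*, Duke Math. J. 53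
  (1986), §1 (1.1)–(1.4). [AshStevens1986]
-/

noncomputable section

namespace Literature.NumberTheory.EllipticCurves

open scoped MatrixGroups
open Literature.NumberTheory.ModularSymbols.FullLevel
open Literature.RepresentationTheory.FiniteGroups.GL2

/-- **The `f_W`-part of the full-level homology `H₁(Y(K(p)K₀(M)), K)` of a potentially good ordinary additive prime
`p ≥ 5` of semistability defect `e ∈ {3, 4, 6}` is isotypic of type the tame principal series `Ind(ω̃^{−b} ⊗ ω̃ᵇ)`,
`e·b = p − 1`.**  Precisely: for `W/ℚ` elliptic, globally minimal, of conductor `p²M` with `p ∤ M`, `5 ≤ p`,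
`W.HasPotentiallyGoodOrdinaryReductionAtPrime p`, `v_p(Δ_min) ≠ 6`, and `b` with `(12 / gcd(12, v_p(Δ_min)))·b = p − 1`:
for every field `K` over `ℚ_p`, every finite-dimensional `K`-representation `σ` of `GL₂(𝔽_p)` on `V` and every
`ℤ_p`-linear `Φ : H₁(Γ₀(M), ℤ_p[GL₂(ℤ/p)]) → V` which is `GL₂(𝔽_p)`-equivariant (`Φ ∘ H1carrierRep g = σ g ∘ Φ`),
HECKE-TRIVIALISED AT `W` (`Φ ∘ T_q = a_q(W)·Φ` for every prime `q ≠ p`, `a_q(W) = W.LFunction q`) and whose image spans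
`V`, the `K[GL₂(𝔽_p)]`-module `V` is isotypic of type `coordRep(ω̃^{p−1−b}, ω̃ᵇ) = Ind(ω̃^{−b} ⊗ ω̃ᵇ)` (Mathlib
`IsIsotypicOfType`).  Sources: Eichler–Shimura decomposition `H¹(X_U, ℚ̄) = (⊕_π B_π⁺ ⊕ B_π⁻)^U`, `B_π^± ≅ π^∞`
[cite: ConradDiamondTaylor1999, §5.3 p. 541 with Lemma 4.2.4 (2) p. 538 and Lemma 7.1.3 (2), Prop. B.4.2 p. 552]
(Shimura Thm. 8.4 / Prop. 8.5; Langlands 1973 §2); inertial type `ω̃ᵇ ⊕ ω̃^{−b}` of `W` at `p`, `Φ_p` cyclic of order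
`e = 12/gcd(12, v_p(Δ))` [cite: Serre1972PointsOrdreFini, §5.6 p. 312] [cite: SerreTate1968GoodReduction, §2 Thm. 2 and Cor. 2]
[cite: Rohrlich1994CRM, §4]; local–global compatibility [cite: Carayol1986ASENS, Thm. (A)]; `K(p)`-invariants of
a tamely ramified principal series `= I(χ₁, χ₂)` [cite: ConradDiamondTaylor1999, Lemma 4.2.4 (2)]; Eisenstein boundary
[cite: AshStevens1986, §1 (1.1)–(1.4)] [cite: ShimuraIATAF1971, Thm. 8.4, Prop. 8.5, §8.3 (8.3.2)] [cite: Langlands1973, §2].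
A named fact (D-0014); asserted nowhere. -/
def fullLevelHomology_isIsotypic_tamePrincipalSeries : Prop :=
  ∀ (p M : ℕ) [Fact p.Prime] [NeZero M] (W : WeierstrassCurve ℚ) [W.IsElliptic] [W.IsGloballyMinimal] (b : ℕ),
    5 ≤ p → Nat.Coprime p M → W.conductorNorm ℤ = p ^ 2 * M →
    W.HasPotentiallyGoodOrdinaryReductionAtPrime p → padicValInt p W.minimalDiscriminantInt ≠ 6 →
    (12 / Nat.gcd 12 (padicValInt p W.minimalDiscriminantInt)) * b = p - 1 →
    ∀ (K : Type) [Field K] [Algebra ℤ_[p] K] [Algebra ℚ_[p] K] [IsScalarTower ℤ_[p] ℚ_[p] K]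
      (V : Type) [AddCommGroup V] [Module K V] [Module ℤ_[p] V] [IsScalarTower ℤ_[p] K V] [Module.Finite K V]
      (σ : Representation K (GL (Fin 2) (ZMod p)) V) (Φ : H1carrier ℤ_[p] p M →ₗ[ℤ_[p]] V),
      (∀ (g : GL (Fin 2) (ZMod p)) (z : H1carrier ℤ_[p] p M), Φ (H1carrierRep ℤ_[p] p M g z) = σ g (Φ z)) →
      (∀ (q : ℕ) [NeZero q] (hq : q.Prime) (hqp : q ≠ p) (z : H1carrier ℤ_[p] p M),
          Φ (heckeT ℤ_[p] p M hq hqp z) = ((W.LFunction q : ℤ) : K) • Φ z) →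
      Submodule.span K (Set.range Φ) = ⊤ →
      IsIsotypicOfType (MonoidAlgebra K (GL (Fin 2) (ZMod p))) σ.asModule
        (coordRep (reduceChar K (Kato2004.teichmullerChar p ^ (p - 1 - b)))
          (reduceChar K (Kato2004.teichmullerChar p ^ b))).asModule

/-! ### Appended (same seat, g27): the same fact with the CENTRAL CHARACTER PINNED (the form consumers should use)

The Hecke operator `heckeT k p M hq hqp` of the tree is the chain-level double-coset operator
`[γ] ⊗ δ_x ↦ Σᵢ [γ'ᵢ] ⊗ δ_{β̄ᵢ x}` (`βᵢ ∈ {(1 j; 0 q), diag(q, 1)}` acting on `k[GL₂(𝔽_p)]` by LEFT translation through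
reduction mod `p`).  On the adelic double quotient `Y(K(p)K₀(M)) = Γ₀(M) \ (ℍ × GL₂(𝔽_p))` the operator `[K diag(q,1) K]`
reads `(τ, x) ↦ Σᵢ (βᵢ τ, q̄⁻¹ β̄ᵢ x)` (push-forward; `q̄⁻¹ = (q·1)⁻¹ ∈ Z(GL₂(𝔽_p))`), so the tree's `T_q` and the adelic `T_q`
differ by the action of the CENTRAL element `q̄^{±1}` (the sign depending on push-forward/pull-back conventions), i.e. by the
value at `q` of the central character on each automorphic part.  On the `f_W`-part (trivial central character) the two agree
(this is the tree theorem `FullLevelHomologySpreadLatticeHecke.spreadPeriod_heckeT`), but the hypothesis «`Φ ∘ T_q = a_q(W)·Φ`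
for the TREE's `T_q`» in `fullLevelHomology_isIsotypic_tamePrincipalSeries` could, with the unfavourable sign and `3 ∣ p − 1`, also
be met by the part of a cubic twist `f_W ⊗ χ̃` (central character `χ²`, `χ³ = 1`), whose `K(p)`-type `I(ω̃^{−b}χ, ω̃ᵇχ)` is NOT the
tame type of `W`.  The variant below adds the hypothesis that the CENTRE `Z(GL₂(𝔽_p)) = {diag(a,a)}` acts trivially on `V`; on
the centre-invariant part every normalisation of `T_q` agrees with the adelic one up to a power of `q` (excluded by the Hasse bound),
so the statement below is the printed theorem independently of that sign, and it is the one the consumer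
(`Λ_Q(f_W)`, on which the centre acts trivially because the spread period map is constant on left `T̃`-cosets) uses.  The first
declaration is kept (append-only tree) and should be read as «modulo the identification of `heckeT` with the adelic `T_q`». -/

/-- **The `f_W`-part of the full-level homology with TRIVIAL CENTRAL CHARACTER is isotypic of type the tame principal series
`Ind(ω̃^{−b} ⊗ ω̃ᵇ)`** (central-character-pinned form of `fullLevelHomology_isIsotypic_tamePrincipalSeries`, the one to use).
For `W/ℚ` elliptic, globally minimal, of conductor `p²M` with `p ∤ M`, `5 ≤ p`, `W.HasPotentiallyGoodOrdinaryReductionAtPrime p`,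
`v_p(Δ_min) ≠ 6` and `(12 / gcd(12, v_p(Δ_min)))·b = p − 1`: for every field `K` over `ℚ_p`, every finite-dimensional
`K`-representation `σ` of `GL₂(𝔽_p)` on `V` ON WHICH THE CENTRE ACTS TRIVIALLY (`σ(diag(a,a)) = 1`), and every `ℤ_p`-linear
`GL₂(𝔽_p)`-equivariant `Φ : H₁(Γ₀(M), ℤ_p[GL₂(ℤ/p)]) → V`, Hecke-trivialised at `W` (`Φ ∘ T_q = a_q(W)·Φ`, all primes `q ≠ p`)
with spanning image, the `K[GL₂(𝔽_p)]`-module `V` is isotypic of type `coordRep(ω̃^{p−1−b}, ω̃ᵇ)` (Mathlib `IsIsotypicOfType`).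
The `a_q(W)`-part of `H₁(Y(K(p)K₀(M)), K)` on which the centre acts trivially is `(π_{f_W}^∞)^{K(p)K₀(M)} ⊗ K²`
(Eichler–Shimura, strong multiplicity one, Chebotarev) and `GL₂(𝔽_p)` acts on `π_{f_W,p}^{K(p)} ≅ I(ω̃^{−b}, ω̃ᵇ)`.
[cite: ConradDiamondTaylor1999, §5.3 p. 541 with Lemma 4.2.4 (2) p. 538 and Lemma 7.1.3 (2), Prop. B.4.2 p. 552]
[cite: Serre1972PointsOrdreFini, §5.6 p. 312] [cite: SerreTate1968GoodReduction, §2 Thm. 2 and Cor. 2] [cite: Rohrlich1994CRM, §4]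
[cite: Carayol1986ASENS, Thm. (A)] [cite: AshStevens1986, §1 (1.1)–(1.4)] [cite: ShimuraIATAF1971, Thm. 8.4, Prop. 8.5, §8.3 (8.3.2)]
[cite: Langlands1973, §2].  A named fact (D-0014); asserted nowhere. -/
def fullLevelHomology_isIsotypic_tamePrincipalSeries_of_central : Prop :=
  ∀ (p M : ℕ) [Fact p.Prime] [NeZero M] (W : WeierstrassCurve ℚ) [W.IsElliptic] [W.IsGloballyMinimal] (b : ℕ),
    5 ≤ p → Nat.Coprime p M → W.conductorNorm ℤ = p ^ 2 * M →
    W.HasPotentiallyGoodOrdinaryReductionAtPrime p → padicValInt p W.minimalDiscriminantInt ≠ 6 →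
    (12 / Nat.gcd 12 (padicValInt p W.minimalDiscriminantInt)) * b = p - 1 →
    ∀ (K : Type) [Field K] [Algebra ℤ_[p] K] [Algebra ℚ_[p] K] [IsScalarTower ℤ_[p] ℚ_[p] K]
      (V : Type) [AddCommGroup V] [Module K V] [Module ℤ_[p] V] [IsScalarTower ℤ_[p] K V] [Module.Finite K V]
      (σ : Representation K (GL (Fin 2) (ZMod p)) V) (Φ : H1carrier ℤ_[p] p M →ₗ[ℤ_[p]] V),
      (∀ (a : (ZMod p)ˣ) (v : V), σ (diagElt (ZMod p) a a) v = v) →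
      (∀ (g : GL (Fin 2) (ZMod p)) (z : H1carrier ℤ_[p] p M), Φ (H1carrierRep ℤ_[p] p M g z) = σ g (Φ z)) →
      (∀ (q : ℕ) [NeZero q] (hq : q.Prime) (hqp : q ≠ p) (z : H1carrier ℤ_[p] p M),
          Φ (heckeT ℤ_[p] p M hq hqp z) = ((W.LFunction q : ℤ) : K) • Φ z) →
      Submodule.span K (Set.range Φ) = ⊤ →
      IsIsotypicOfType (MonoidAlgebra K (GL (Fin 2) (ZMod p))) σ.asModule
        (coordRep (reduceChar K (Kato2004.teichmullerChar p ^ (p - 1 - b)))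
          (reduceChar K (Kato2004.teichmullerChar p ^ b))).asModule

end Literature.NumberTheory.EllipticCurves
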